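/-
Copyright: derived here (Resolution Observatory cell `pub-rosobs`, carver gen 58). AI-written Lean; AI review is weaker than expert
review.  The HASSE-DERIVATIVE KILL of engine 1's THEOREM B″ (THEOREM-LT-eng1-g38 §11): in characteristic `p`, a polynomial of degree
`≤ p+1` whose Hasse derivatives of orders `2` and `p` vanish is affine-linear.  Instrument — NOT a resolution theorem and NOT a statement
about the invariant of [AbramovichTemkinWlodarczyk2024].
-/
import Mathlib.Algebra.Polynomial.HasseDeriv
import Mathlib.Algebra.CharP.Lemmas
import Mathlib.Data.Nat.Choose.Dvd
import HarnessLib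

/-!
# The Hasse-derivative kill (THEOREM B″, `W`-side): `D^{(2)}Q = D^{(p)}Q = 0`, `deg Q ≤ p+1` ⇒ `Q = Q₀ + W_n Q₁`

Uniform value line: INSTRUMENT — elementary algebra for engine 1's THEOREM B″ in the cell's polynomial weighted-centre model `W(f)`;
NOT a resolution theorem, NOT a statement about the Abramovich–Temkin–Włodarczyk invariant, NOT summit progress; AI-written Lean, AI
review is weaker than expert review.

## Dictionary (THEOREM-LT §11, proof of THEOREM B″ ↔ this file)

The engine: "W-coordinates with `c = e_n`: `Q = Σ_a W_n^a Q_a(W′)`; `D^{(k)}_{e_n}Q = Σ_a C(a,k) W_n^{a−k} Q_a = 0` for `2 ≤ k ≤ p`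
kills `Q_a` for `2 ≤ a ≤ p−1` (`C(a,2) ≠ 0`), `a = p` (`C(p,p) = 1`) and `a = p+1` (`C(p+1,p) = p+1 ≡ 1`): `Q = Q₀(W′) + W_nQ₁(W′)`."
Here `Q` is a univariate polynomial in `W_n` over the coefficient ring `A = k[W′]` (any commutative ring of characteristic `p` without
zero divisors), `D^{(k)}_{e_n}` is Mathlib's `Polynomial.hasseDeriv k`, and only the two orders `k = 2` and `k = p` are used:
`coeff_eq_zero_of_hasseDeriv_two` (`2 ≤ a ≤ p−1`), `coeff_eq_zero_of_hasseDeriv_p` (`a = p`), `coeff_succ_eq_zero_of_hasseDeriv_p`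
(`a = p+1`), assembled in `natDegree_le_one_of_hasseDeriv_eq_zero`.  The binomial units `C(a,2) ≢ 0 (a < p)`, `C(p+1,p) ≡ 1` are
`WeightedCentreTwoClassArith.cast_choose_ne_zero` / `cast_choose_succ_self` (used inline here, since that module is not yet built for
importers).  (Why `k = 2` alone does not suffice at `a = p, p+1`: `TwoClassArith.dvd_choose_two_self` / `dvd_choose_two_succ`.)

References: engine 1, THEOREM-LT-eng1-g38 §11; Hasse derivatives [Lang2002, Ch. IV §1]; context [AbramovichTemkinWlodarczyk2024] §5.
Statement and formalisation ours, elementary.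
-/

namespace Literature.AlgebraicGeometry.Resolution.WeightedBlowup

namespace HasseKill

open Polynomial

variable {A : Type*} [CommRing A] [NoZeroDivisors A] (p : ℕ) [Fact p.Prime] [CharP A p]

/-- `D^{(2)}Q = 0` kills the coefficients of `W_n^a` for `2 ≤ a < p` (`C(a,2)` is a unit mod `p`; ours). [cite: Lang2002, Ch. IV §1] -/
theorem coeff_eq_zero_of_hasseDeriv_two (Q : A[X]) (h2 : hasseDeriv 2 Q = 0) {a : ℕ} (ha : 2 ≤ a) (hap : a < p) :
    Q.coeff a = 0 := by
  have h := congrArg (fun P : A[X] => P.coeff (a - 2)) h2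
  simp only [hasseDeriv_coeff, coeff_zero, Nat.sub_add_cancel ha] at h
  rcases mul_eq_zero.mp h with h | h
  · exfalso
    have hp : p.Prime := Fact.out
    rw [CharP.cast_eq_zero_iff A p] at h
    exact (Nat.Prime.coprime_iff_not_dvd hp).mp (hp.coprime_choose_of_lt hap ha) h
  · exact h

omit [NoZeroDivisors A] [Fact p.Prime] [CharP A p] in
/-- `D^{(p)}Q = 0` kills the coefficient of `W_n^p` (`C(p,p) = 1`; ours). [cite: Lang2002, Ch. IV §1] -/
theorem coeff_eq_zero_of_hasseDeriv_p (Q : A[X]) (hp : hasseDeriv p Q = 0) : Q.coeff p = 0 := by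
  have h := congrArg (fun P : A[X] => P.coeff 0) hp
  simpa [hasseDeriv_coeff] using h

omit [NoZeroDivisors A] [Fact p.Prime] in
/-- `D^{(p)}Q = 0` kills the coefficient of `W_n^{p+1}` (`C(p+1,p) = p+1 ≡ 1`; ours). [cite: Lang2002, Ch. IV §1] -/
theorem coeff_succ_eq_zero_of_hasseDeriv_p (Q : A[X]) (hp : hasseDeriv p Q = 0) : Q.coeff (p + 1) = 0 := by
  have h := congrArg (fun P : A[X] => P.coeff 1) hp
  simp only [hasseDeriv_coeff, coeff_zero, Nat.add_comm 1 p] at h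
  rwa [Nat.choose_succ_self_right, Nat.cast_succ, CharP.cast_eq_zero A p, zero_add, one_mul] at h

/-- **The Hasse kill** (THEOREM B″, `W`-side; ours as a formal statement): in characteristic `p`, a polynomial of degree `≤ p+1` with
`D^{(2)}Q = 0` and `D^{(p)}Q = 0` has degree `≤ 1` — "`Q = Q₀(W′) + W_n Q₁(W′)`". [cite: Lang2002, Ch. IV §1] -/
theorem natDegree_le_one_of_hasseDeriv_eq_zero (Q : A[X]) (hdeg : Q.natDegree ≤ p + 1) (h2 : hasseDeriv 2 Q = 0)
    (hp : hasseDeriv p Q = 0) : Q.natDegree ≤ 1 := by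
  rw [natDegree_le_iff_coeff_eq_zero]
  intro a ha
  have ha2 : 2 ≤ a := by exact_mod_cast ha
  rcases lt_or_ge a p with hap | hpa
  · exact coeff_eq_zero_of_hasseDeriv_two p Q h2 ha2 hap
  rcases hpa.eq_or_lt with rfl | hpa'
  · exact coeff_eq_zero_of_hasseDeriv_p p Q hp
  rcases (Nat.succ_le_of_lt hpa').eq_or_lt with h | h
  · rw [← h]
    exact coeff_succ_eq_zero_of_hasseDeriv_p p Q hp
  · exact coeff_eq_zero_of_natDegree_lt (lt_of_le_of_lt hdeg h)

/-- The same with all intermediate orders (the engine's "`D^{(k)}_{e_n}Q = 0` for `2 ≤ k ≤ p`"; ours). [cite: Lang2002, Ch. IV §1] -/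
theorem natDegree_le_one_of_forall_hasseDeriv_eq_zero (Q : A[X]) (hdeg : Q.natDegree ≤ p + 1)
    (h : ∀ k, 2 ≤ k → k ≤ p → hasseDeriv k Q = 0) : Q.natDegree ≤ 1 :=
  natDegree_le_one_of_hasseDeriv_eq_zero p Q hdeg (h 2 le_rfl (Fact.out : p.Prime).two_le) (h p (Fact.out : p.Prime).two_le le_rfl)

end HasseKill

end Literature.AlgebraicGeometry.Resolution.WeightedBlowup
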